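import Summits.NavierStokesRegularity.NavierStokesRegularity.Theorems.SoloSalvageWu2026ConstructCompactTools
import Summits.NavierStokesRegularity.NavierStokesRegularity.Theorems.SoloSalvageWu2026ConstructProfile
import Mathlib.MeasureTheory.Measure.Lebesgue.EqHaar
import HarnessLib

/-!
# C177 `Wu2026` — toward `Step_construct` (E), Sobolev bounds (3.35): the strong `L^{9/5}` bounds
# (3.32)–(3.33) of `curl V_j` and `V_j` on the dyadic shells `{1 < |y| < 2^{N+1}}` at good scales

Seat `ns-in-wu-341` on sub-binder (E) of `step_construct_of_pieces` (cut owner `ns-inputs-plan` g5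
ruling 08:24Z «wu-341 TAKE (i) + (E)»; holder of `Step_construct` = `ns-in-wu-con`). Salvage
conventions: theorems only, standard axioms, no definition, no named fact; `--supports` item 0897.

Print (arXiv:2608.22471v1, p.13 l.1–40): «critical scaling and (3.9) give, for every fixed m ≥ 0,
∫_{A_{2^m}} |curl V_j|^{9/5} dy = a_{n_j+m} ≤ B_m whenever j ≥ max{1, m}. (3.32) … Taking q = 9/5
in (3.18) and using A_{2^{n_j+m}} = R_j A_{2^m}, we obtain ‖V_j‖_{L^{9/5}(A_{2^m})} ≤ CM 2^m. (3.33)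
… the finite family {A_{2^m} : 0 ≤ m ≤ N} covers G′ up to its spherical boundaries, which have
measure zero. For every j ≥ max{1, N}, (3.32) holds simultaneously for all 0 ≤ m ≤ N.»

* `curl_blowDown` — `curl V_R(y) = R^{5/3} (curl v)(Ry)` (written `(R^{2/3}·R) •`);
* `integral_annulus_curl_blowDown` — (3.32) as an identity:
  `∫_{A_S} |curl V_R|^{9/5} = ∫_{A_{RS}} |curl v|^{9/5}` (`(5/3)(9/5) = 3` cancels the Jacobian);
* `lintegral_shell_le_sum_annulus` — the shell `{1 < |y| < 2^{N+1}}` is covered by the annuli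
  `A_{2^m}`, `m ≤ N`, up to null spheres: `∫_{shell} f ≤ Σ_{m ≤ N} ∫_{A_{2^m}} f`;
* `exists_lintegral_shell_curl_blowDown_le` — (3.32) summed: at good scales `j ≥ max 1 N`,
  `∫_{1<|y|<2^{N+1}} |curl V_j|^{9/5} ≤ Σ_{m≤N} B_m`;
* `exists_lintegral_shell_blowDown_le` — (3.33) summed: `∫_{1<|y|<2^{N+1}} |V_j|^{9/5} ≤ C_N` for
  all `j` (every scale), from (3.18) with `q = 9/5` (wu-con's `integral_annulus_blowDown_rpow_le`).

WHAT THIS IS NOT: not a proof of `Step_construct`; not a claim about NS regularity or blow-up; not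
a claim about any author beyond the typed locator.
-/

noncomputable section

set_option linter.dupNamespace false

open MeasureTheory Set Function Filter Topology Metric
open scoped ENNReal NNReal RealInnerProductSpace

namespace Summit.NavierStokesRegularity.NavierStokesRegularity.Theorems.Wu2026Salvage

open Literature.Claims.NS.Wu2026 Literature.Analysis.FluidPDE Literature.Analysis.FunctionSpaces

/-! ### (3.32): the vorticity of the blow-down -/

/-- **`curl V_R(y) = R^{5/3}(curl v)(Ry)`** (written with the factor `R^{2/3}·R` of
`fderiv_blowDown`): the curl is a fixed linear map of the Jacobian. [cite: Wu2026, (1.2) p.2 l.5–9, (3.32) p.13] -/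
theorem curl_blowDown (v : E3 → E3) {R : ℝ} (hR : R ≠ 0) (y : E3) :
    curl (blowDown R v) y = (R ^ ((2 : ℝ) / 3) * R) • curl v (R • y) := by
  rw [curl_eq_curlCLM, curl_eq_curlCLM, fderiv_blowDown v hR y, map_smul]

/-- **(3.32) as an identity**: `∫_{A_S} |curl V_R|^{9/5} dy = ∫_{A_{RS}} |curl v|^{9/5} dx` for
`R > 0` — `|curl V_R(y)|^{9/5} = R³ |curl v(Ry)|^{9/5}` and `dx = R³ dy`. [cite: Wu2026, (3.32) p.13 l.6–9] -/
theorem integral_annulus_curl_blowDown (v : E3 → E3) {R : ℝ} (hR : 0 < R) (S : ℝ) :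
    ∫ y in annulus S, ‖curl (blowDown R v) y‖ ^ ((9 : ℝ) / 5) =
      ∫ x in annulus (R * S), ‖curl v x‖ ^ ((9 : ℝ) / 5) := by
  have hR53 : 0 < R ^ ((2 : ℝ) / 3) * R := by positivity
  have hpow : (R ^ ((2 : ℝ) / 3) * R) ^ ((9 : ℝ) / 5) = R ^ (3 : ℕ) := by
    rw [show R ^ ((2 : ℝ) / 3) * R = R ^ ((2 : ℝ) / 3) * R ^ (1 : ℝ) by rw [Real.rpow_one],
      ← Real.rpow_add hR, ← Real.rpow_mul hR.le]
    norm_num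
  have hfun : (fun y : E3 => ‖curl (blowDown R v) y‖ ^ ((9 : ℝ) / 5)) =
      fun y => R ^ (3 : ℕ) * (fun x => ‖curl v x‖ ^ ((9 : ℝ) / 5)) (R • y) := by
    funext y
    rw [curl_blowDown v hR.ne' y, norm_smul, Real.norm_of_nonneg hR53.le,
      Real.mul_rpow hR53.le (norm_nonneg _), hpow]
  rw [hfun, integral_const_mul, Measure.setIntegral_comp_smul_of_pos (volume : Measure E3)
    (fun x => ‖curl v x‖ ^ ((9 : ℝ) / 5)) (annulus S) hR, smul_annulus hR, finrank_euclideanSpace,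
    Fintype.card_fin, smul_eq_mul, ← mul_assoc, mul_inv_cancel₀ (pow_ne_zero 3 hR.ne'), one_mul]

/-- **(3.32)**: `∫_{A_{2^m}} |curl V_j|^{9/5} = a_{n_j + m}` for `R_j = 2^{n_j}` (`dyMass`). [cite: Wu2026, (3.32) p.13 l.6–9] -/
theorem integral_annulus_curl_blowDown_eq_dyMass (v : E3 → E3) (k m : ℕ) :
    ∫ y in annulus ((2 : ℝ) ^ m), ‖curl (blowDown ((2 : ℝ) ^ k) v) y‖ ^ ((9 : ℝ) / 5) =
      dyMass v (k + m) := by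
  rw [integral_annulus_curl_blowDown v (pow_pos two_pos k), ← pow_add]
  rfl

/-! ### The shells `{1 < |y| < 2^{N+1}}` are covered by annuli up to null spheres -/

/-- `{1 < |y| < 2^{N+2}} ⊆ {1 < |y| < 2^{N+1}} ∪ sphere(0, 2^{N+1}) ∪ A_{2^{N+1}}`. [folklore] -/
theorem shell_succ_subset (N : ℕ) :
    {y : E3 | 1 < ‖y‖ ∧ ‖y‖ < (2 : ℝ) ^ (N + 2)} ⊆
      ({y : E3 | 1 < ‖y‖ ∧ ‖y‖ < (2 : ℝ) ^ (N + 1)} ∪ sphere (0 : E3) ((2 : ℝ) ^ (N + 1))) ∪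
        annulus ((2 : ℝ) ^ (N + 1)) := by
  intro y hy
  rcases lt_trichotomy ‖y‖ ((2 : ℝ) ^ (N + 1)) with h | h | h
  · exact Or.inl (Or.inl ⟨hy.1, h⟩)
  · refine Or.inl (Or.inr ?_)
    rw [mem_sphere, dist_zero_right]; exact h
  · refine Or.inr ⟨h, ?_⟩
    have : (2 : ℝ) ^ (N + 2) = 2 * 2 ^ (N + 1) := by ring
    rw [← this]; exact hy.2

/-- **The finite family `{A_{2^m} : m ≤ N}` covers the shell up to null spheres**:
`∫_{1<|y|<2^{N+1}} f ≤ Σ_{m ≤ N} ∫_{A_{2^m}} f` for every `f ≥ 0` (p.13 l.22–25 «covers G′ up to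
its spherical boundaries, which have measure zero»). [cite: Wu2026, p.13 l.22–25] -/
theorem lintegral_shell_le_sum_annulus (f : E3 → ℝ≥0∞) (N : ℕ) :
    ∫⁻ y in {y : E3 | 1 < ‖y‖ ∧ ‖y‖ < (2 : ℝ) ^ (N + 1)}, f y ≤
      ∑ m ∈ Finset.range (N + 1), ∫⁻ y in annulus ((2 : ℝ) ^ m), f y := by
  induction N with
  | zero =>
    rw [Finset.sum_range_one]
    refine le_of_eq (congrArg (fun s => ∫⁻ y in s, f y) ?_)
    ext y
    simp [annulus]
  | succ N ih =>
    rw [Finset.sum_range_succ]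
    have hsph : ∫⁻ y in sphere (0 : E3) ((2 : ℝ) ^ (N + 1)), f y = 0 :=
      setLIntegral_measure_zero _ _ (Measure.addHaar_sphere volume 0 _)
    calc ∫⁻ y in {y : E3 | 1 < ‖y‖ ∧ ‖y‖ < (2 : ℝ) ^ (N + 1 + 1)}, f y
        ≤ ∫⁻ y in ({y : E3 | 1 < ‖y‖ ∧ ‖y‖ < (2 : ℝ) ^ (N + 1)} ∪ sphere (0 : E3) ((2 : ℝ) ^ (N + 1))) ∪
            annulus ((2 : ℝ) ^ (N + 1)), f y := lintegral_mono_set (shell_succ_subset N)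
      _ ≤ (∫⁻ y in {y : E3 | 1 < ‖y‖ ∧ ‖y‖ < (2 : ℝ) ^ (N + 1)} ∪ sphere (0 : E3) ((2 : ℝ) ^ (N + 1)),
            f y) + ∫⁻ y in annulus ((2 : ℝ) ^ (N + 1)), f y := lintegral_union_le _ _ _
      _ ≤ ((∫⁻ y in {y : E3 | 1 < ‖y‖ ∧ ‖y‖ < (2 : ℝ) ^ (N + 1)}, f y) +
            ∫⁻ y in sphere (0 : E3) ((2 : ℝ) ^ (N + 1)), f y) +
            ∫⁻ y in annulus ((2 : ℝ) ^ (N + 1)), f y :=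
          add_le_add (lintegral_union_le _ _ _) le_rfl
      _ ≤ (∑ m ∈ Finset.range (N + 1), ∫⁻ y in annulus ((2 : ℝ) ^ m), f y) +
            ∫⁻ y in annulus ((2 : ℝ) ^ (N + 1)), f y := by
          rw [hsph, add_zero]; exact add_le_add ih le_rfl

/-! ### (3.32) and (3.33) on the shells -/

/-- A continuous function has `∫⁻_{A_S} ofReal(g) = ofReal(∫_{A_S} g)` on an annulus
(integrable: continuous on the compact closed shell). [folklore] -/
theorem lintegral_annulus_ofReal_eq {g : E3 → ℝ} (hg : Continuous g) (hg0 : ∀ y, 0 ≤ g y) (S : ℝ) :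
    ∫⁻ y in annulus S, ENNReal.ofReal (g y) = ENNReal.ofReal (∫ y in annulus S, g y) := by
  have hint : IntegrableOn g (annulus S) volume :=
    (hg.continuousOn.integrableOn_compact (isCompact_closedShell S)).mono_set
      (annulus_subset_closedShell S)
  rw [ofReal_integral_eq_lintegral_ofReal hint (Eventually.of_forall fun y => hg0 y)]

/-- `V_R ∈ C¹` for `v ∈ C¹`. [folklore] -/
theorem contDiff_one_blowDown {v : E3 → E3} (hv : ContDiff ℝ 1 v) (R : ℝ) :
    ContDiff ℝ 1 (blowDown R v) := by
  unfold blowDown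
  exact (hv.comp (contDiff_const_smul R)).const_smul _

/-- **(3.32) on the shell at good scales**: if `a_{n_j+m} ≤ B_m` for `j ≥ max{1,m}` then for every
`N` and every `j ≥ max{1, N}`, `∫_{1<|y|<2^{N+1}} |curl V_j|^{9/5} ≤ Σ_{m≤N} max(B_m, 0)`
(`V_j = blowDown 2^{n_j} v`, `v ∈ C¹`). [cite: Wu2026, (3.32) p.13 l.6–30] -/
theorem exists_lintegral_shell_curl_blowDown_le {v : E3 → E3} (hv : ContDiff ℝ 1 v) {n : ℕ → ℕ}
    (hgood : ∀ m : ℕ, ∃ B : ℝ, ∀ j : ℕ, max 1 m ≤ j → dyMass v (n j + m) ≤ B) (N : ℕ) :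
    ∃ B : ℝ, ∀ j : ℕ, max 1 N ≤ j →
      ∫⁻ y in {y : E3 | 1 < ‖y‖ ∧ ‖y‖ < (2 : ℝ) ^ (N + 1)},
        ‖curl (blowDown ((2 : ℝ) ^ n j) v) y‖ₑ ^ ((9 : ℝ) / 5) ≤ ENNReal.ofReal B := by
  choose B hB using hgood
  refine ⟨∑ m ∈ Finset.range (N + 1), max (B m) 0, fun j hj => ?_⟩
  have hcont : Continuous (curl (blowDown ((2 : ℝ) ^ n j) v)) :=
    continuous_curl (contDiff_one_blowDown hv _)
  refine (lintegral_shell_le_sum_annulus _ N).trans ?_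
  rw [ENNReal.ofReal_sum_of_nonneg (fun m _ => le_max_right _ _)]
  refine Finset.sum_le_sum fun m hm => ?_
  have hmN : m ≤ N := Nat.lt_succ_iff.1 (Finset.mem_range.1 hm)
  have hjm : max 1 m ≤ j := (max_le_max le_rfl hmN).trans hj
  calc ∫⁻ y in annulus ((2 : ℝ) ^ m), ‖curl (blowDown ((2 : ℝ) ^ n j) v) y‖ₑ ^ ((9 : ℝ) / 5)
      = ∫⁻ y in annulus ((2 : ℝ) ^ m),
          ENNReal.ofReal (‖curl (blowDown ((2 : ℝ) ^ n j) v) y‖ ^ ((9 : ℝ) / 5)) :=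
        lintegral_congr fun y => (ofReal_norm_rpow _ (by norm_num)).symm
    _ = ENNReal.ofReal (dyMass v (n j + m)) := by
        rw [lintegral_annulus_ofReal_eq (hcont.norm.rpow_const fun _ => Or.inr (by norm_num))
          (fun y => Real.rpow_nonneg (norm_nonneg _) _), integral_annulus_curl_blowDown_eq_dyMass]
    _ ≤ ENNReal.ofReal (max (B m) 0) :=
        ENNReal.ofReal_le_ofReal ((hB m j hjm).trans (le_max_left _ _))

/-- **(3.33) on the shell, every scale**: from (3.18) with `q = 9/5`,
`∫_{1<|y|<2^{N+1}} |V_R|^{9/5} ≤ Σ_{m≤N} (C·(2^m))^{9/5}` for every `R > 0` (`−2/3 + 3/(9/5) = 1`;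
wu-con's `integral_annulus_blowDown_rpow_le`). [cite: Wu2026, (3.33) p.13 l.10–14] -/
theorem exists_lintegral_shell_blowDown_le {v : E3 → E3} (hv : Continuous v)
    (h318 : ∃ C : ℝ, ∀ R : ℝ, 0 < R → IntegrableOn (fun x => ‖v x‖ ^ ((9 : ℝ) / 5)) (annulus R) ∧
      (∫ x in annulus R, ‖v x‖ ^ ((9 : ℝ) / 5)) ^ (1 / ((9 : ℝ) / 5)) ≤
        C * R ^ (-(2 : ℝ) / 3 + 3 / ((9 : ℝ) / 5))) (N : ℕ) :
    ∃ B : ℝ, ∀ R : ℝ, 0 < R →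
      ∫⁻ y in {y : E3 | 1 < ‖y‖ ∧ ‖y‖ < (2 : ℝ) ^ (N + 1)},
        ‖blowDown R v y‖ₑ ^ ((9 : ℝ) / 5) ≤ ENNReal.ofReal B := by
  obtain ⟨C, hC⟩ := h318
  refine ⟨∑ m ∈ Finset.range (N + 1),
    max ((C * ((2 : ℝ) ^ m) ^ (-(2 : ℝ) / 3 + 3 / ((9 : ℝ) / 5))) ^ ((9 : ℝ) / 5)) 0, fun R hR => ?_⟩
  have hcont : Continuous (blowDown R v) := continuous_blowDown hv R
  refine (lintegral_shell_le_sum_annulus _ N).trans ?_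
  rw [ENNReal.ofReal_sum_of_nonneg (fun m _ => le_max_right _ _)]
  refine Finset.sum_le_sum fun m _ => ?_
  calc ∫⁻ y in annulus ((2 : ℝ) ^ m), ‖blowDown R v y‖ₑ ^ ((9 : ℝ) / 5)
      = ∫⁻ y in annulus ((2 : ℝ) ^ m), ENNReal.ofReal (‖blowDown R v y‖ ^ ((9 : ℝ) / 5)) :=
        lintegral_congr fun y => (ofReal_norm_rpow _ (by norm_num)).symm
    _ = ENNReal.ofReal (∫ y in annulus ((2 : ℝ) ^ m), ‖blowDown R v y‖ ^ ((9 : ℝ) / 5)) :=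
        lintegral_annulus_ofReal_eq (hcont.norm.rpow_const fun _ => Or.inr (by norm_num))
          (fun y => Real.rpow_nonneg (norm_nonneg _) _) _
    _ ≤ ENNReal.ofReal (max ((C * ((2 : ℝ) ^ m) ^ (-(2 : ℝ) / 3 + 3 / ((9 : ℝ) / 5))) ^ ((9 : ℝ) / 5)) 0) :=
        ENNReal.ofReal_le_ofReal ((integral_annulus_blowDown_rpow_le (by norm_num) hC hR
          (pow_pos two_pos m)).trans (le_max_left _ _))

end Summit.NavierStokesRegularity.NavierStokesRegularity.Theorems.Wu2026Salvage

end

-- WHAT THIS IS NOT: not a claim about NS regularity or blow-up; not a claim about any author beyond the typed locator.
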